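import Mathlib
import Literature.NumberTheory.LFunctions.Zhang2022.Section11WindowMeanSquareJ2
import Literature.NumberTheory.LFunctions.Zhang2022.TypedSection11A
import HarnessLib

/-!
# Zhang (2022) §11 p. 64: the coefficients of the two window sequences are `≪ 𝓛⁻¹⁰` (from (11.3))
# and live on three multiplicative windows `(xη₋, xη₊)`

Topic `Literature/NumberTheory/LFunctions/Zhang2022` (Landau–Siegel audit tree; verdict-neutral).
Y. Zhang, *Discrete mean estimates and the Landau–Siegel zero*, arXiv:2211.02515v1 (2022)
[Zhang2022LandauSiegel] — **an unrefereed manuscript under adjudication; nothing here asserts or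
denies its Theorems 1–2.** Companion of `Section11WindowMeanSquare(J2)` (leaves h19/h19J2 =
`Typed.TypedSection11B.Step11u019` / `Step11u019J2`, cell GAP row G-L3t10-1): the INPUT DATA that the
arithmetic half ("simple estimates": an `S_j`-bound for sequences of size `≤ B` supported on windows
`(x_kη₋, x_kη₊)`) needs about the two window sequences, as kernel theorems:

* `abs_ftilde_sub_gtilde1_le` — (11.3) of Lemma 11.1 on `𝔍₁ ∩ ℕ`: `|f̃(log n/log P) − g̃₁(n)| ≤ C𝓛⁻¹⁰`
  for `n ∈ frakI1Nat D`, `D` large (from the tree theorem `Typed.Sec11A.lemma111_of_P`); and its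
  `J₂`-transport `abs_ftilde_sub_gtilde2_le`: `|f̃(log n/log P + 0.004 − α̃) − g̃₂(n)| ≤ C𝓛⁻¹⁰` for
  `n ∈ frakI2Nat D` (`g̃₂(y) = g̃₁(yP^{0.004}/(Dt₀))`, `tentArg_J2_eq`, both tree identities);
* `norm_window_le` / `norm_window₂_le` — hence the two inline window sequences of
  `Section11WindowMeanSquare(J2)` are bounded by `C𝓛⁻¹⁰` termwise (and vanish off `𝔍₁ ∩ ℕ`,
  resp. `𝔍₂ ∩ ℕ`, by definition);
* `mem_frakI2Nat_iff_windows` — `𝔍₂ ∩ ℕ` is the union of the three windows `(x_aη₋, x_aη₊)` with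
  centres `x_a = P^aDt₀/P^{0.004}`, `a ∈ {0.5, 0.502, 0.504}` (for `𝔍₁ ∩ ℕ` this is the tree's
  `mem_frakI1Nat_iff` + `mem_frakI1_iff`, centres `P^a`), and `windowCentre₂_le_P1_mul` — these
  centres are `≤ P₁Dt₀`.

0 new definitions, 0 facts; standard axioms.

## References

* Y. Zhang, arXiv:2211.02515v1 (2022), §11 Lemma 11.1 (11.3) p. 63, p. 64 (tex L3295–L3307), §2
  (2.30). [cite: Zhang2022LandauSiegel, §11 Lemma 11.1, p. 64]
-/

noncomputable section

open Complex Real ComplexConjugate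

namespace Literature.NumberTheory.LFunctions.Zhang2022.Section11WindowMeanSquare

open Literature.NumberTheory.LFunctions.Zhang2022.Skeleton
open Literature.NumberTheory.LFunctions.Zhang2022.Typed.TypedSection11B

/-! ### (11.3) on the integer windows -/

/-- **(11.3) on `𝔍₁ ∩ ℕ` from Lemma 11.1**: `|f̃(log n/log P) − g̃₁(n)| ≤ C𝓛⁻¹⁰` for
`n ∈ frakI1Nat D`, `D` large. [cite: Zhang2022LandauSiegel, §11 Lemma 11.1 (11.3), p. 63] -/
theorem abs_ftilde_sub_gtilde1_le_of_lemma111 (h : Lemma111) :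
    ∃ C : ℝ, 0 ≤ C ∧ ForAllLarge fun D _ _ => ∀ n ∈ frakI1Nat D,
      |ftilde (Real.log n / Real.log (bigP D)) - gtilde1 D n| ≤ C * (ell D ^ 10)⁻¹ := by
  obtain ⟨c, -, C, D₀, h⟩ := h
  refine ⟨|C|, abs_nonneg C, D₀, fun D _ χ hD hq hp n hn => ?_⟩
  rw [mem_frakI1Nat_iff, mem_frakI1_iff] at hn
  have hℓ : 0 ≤ (ell D ^ 10)⁻¹ := inv_nonneg.mpr (pow_nonneg (Real.log_natCast_nonneg D) 10)
  exact le_trans ((h D χ hD hq hp (n : ℝ)).2 hn) (mul_le_mul_of_nonneg_right (le_abs_self C) hℓ)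

/-- **(11.3) on `𝔍₁ ∩ ℕ`**, unconditionally (Lemma 11.1 is the tree theorem
`Typed.Sec11A.lemma111_of_P`). [cite: Zhang2022LandauSiegel, §11 Lemma 11.1 (11.3), p. 63] -/
theorem abs_ftilde_sub_gtilde1_le :
    ∃ C : ℝ, 0 ≤ C ∧ ForAllLarge fun D _ _ => ∀ n ∈ frakI1Nat D,
      |ftilde (Real.log n / Real.log (bigP D)) - gtilde1 D n| ≤ C * (ell D ^ 10)⁻¹ :=
  abs_ftilde_sub_gtilde1_le_of_lemma111 Typed.Sec11A.lemma111_of_P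

/-- **(11.3) transported to `𝔍₂ ∩ ℕ`** ("Similarly", p. 64): for `n ∈ frakI2Nat D`,
`|f̃(log n/log P + 0.004 − α̃) − g̃₂(n)| ≤ C𝓛⁻¹⁰` — since `g̃₂(n) = g̃₁(Yₙ)` and
`log n/log P + 0.004 − α̃ = log Yₙ/log P` with `Yₙ = nP^{0.004}/(Dt₀) ∈ 𝔍₁`.
[cite: Zhang2022LandauSiegel, §11 Lemma 11.1 (11.3), p. 64 tex L3306] -/
theorem abs_ftilde_sub_gtilde2_le_of_lemma111 (h : Lemma111) :
    ∃ C : ℝ, 0 ≤ C ∧ ForAllLarge fun D _ _ => ∀ n ∈ frakI2Nat D,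
      |ftilde (Real.log n / Real.log (bigP D) + 0.004 - alphaTilde D) - gtilde2 D n| ≤
        C * (ell D ^ 10)⁻¹ := by
  obtain ⟨c, -, C, D₀, h⟩ := h
  refine ⟨|C|, abs_nonneg C, max D₀ 2, fun D _ χ hD hq hp n hn => ?_⟩
  have hD2 : 2 ≤ D := le_trans (le_max_right _ _) hD
  have hn0 : (0 : ℝ) < n := by exact_mod_cast (pos_and_lt_of_mem_frakI2Nat D hD2 hn).1
  rw [tentArg_J2_eq hD2 hn0, gtilde2_eq_gtilde1_scaleJ2 hD2]
  rw [mem_frakI2Nat_iff hD2, mem_frakI1_iff] at hn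
  have hℓ : 0 ≤ (ell D ^ 10)⁻¹ := inv_nonneg.mpr (pow_nonneg (Real.log_natCast_nonneg D) 10)
  exact le_trans ((h D χ (le_trans (le_max_left _ _) hD) hq hp (scaleJ2 D n)).2 hn)
    (mul_le_mul_of_nonneg_right (le_abs_self C) hℓ)

/-- **(11.3) on `𝔍₂ ∩ ℕ`**, unconditionally. [cite: Zhang2022LandauSiegel, §11 p. 64 tex L3306] -/
theorem abs_ftilde_sub_gtilde2_le :
    ∃ C : ℝ, 0 ≤ C ∧ ForAllLarge fun D _ _ => ∀ n ∈ frakI2Nat D,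
      |ftilde (Real.log n / Real.log (bigP D) + 0.004 - alphaTilde D) - gtilde2 D n| ≤
        C * (ell D ^ 10)⁻¹ :=
  abs_ftilde_sub_gtilde2_le_of_lemma111 Typed.Sec11A.lemma111_of_P

/-! ### The window sequences are `≪ 𝓛⁻¹⁰` termwise -/

/-- **The `𝔍₁`-window sequence is bounded by `C𝓛⁻¹⁰` termwise** (`|χ| ≤ 1` and (11.3); off
`𝔍₁ ∩ ℕ` it is `0`), `D` large. [cite: Zhang2022LandauSiegel, §11 p. 64, tex L3295–L3301] -/
theorem norm_window_le :
    ∃ C : ℝ, 0 ≤ C ∧ ForAllLarge fun D _ χ => ∀ n : ℕ,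
      ‖(if n ∈ frakI1Nat D then χ (n : ZMod D) *
        (((ftilde (Real.log n / Real.log (bigP D)) : ℝ) : ℂ) - ((gtilde1 D n : ℝ) : ℂ)) else 0)‖ ≤
        C * (ell D ^ 10)⁻¹ := by
  obtain ⟨C, hC, D₀, h⟩ := abs_ftilde_sub_gtilde1_le
  refine ⟨C, hC, D₀, fun D _ χ hD hq hp n => ?_⟩
  have hℓ : 0 ≤ (ell D ^ 10)⁻¹ := inv_nonneg.mpr (pow_nonneg (Real.log_natCast_nonneg D) 10)
  by_cases hn : n ∈ frakI1Nat D
  · rw [if_pos hn, norm_mul, ← Complex.ofReal_sub, Complex.norm_real, Real.norm_eq_abs]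
    calc ‖χ (n : ZMod D)‖ * |ftilde (Real.log n / Real.log (bigP D)) - gtilde1 D n|
        ≤ 1 * (C * (ell D ^ 10)⁻¹) :=
          mul_le_mul (DirichletCharacter.norm_le_one _ _) (h D χ hD hq hp n hn) (abs_nonneg _)
            zero_le_one
      _ = C * (ell D ^ 10)⁻¹ := one_mul _
  · rw [if_neg hn, norm_zero]; positivity

/-- **The `𝔍₂`-window sequence is bounded by `C𝓛⁻¹⁰` termwise**, `D` large.
[cite: Zhang2022LandauSiegel, §11 p. 64, tex L3306] -/
theorem norm_window₂_le :
    ∃ C : ℝ, 0 ≤ C ∧ ForAllLarge fun D _ χ => ∀ n : ℕ,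
      ‖(if n ∈ frakI2Nat D then χ (n : ZMod D) *
        (((ftilde (Real.log n / Real.log (bigP D) + 0.004 - alphaTilde D) : ℝ) : ℂ) -
          ((gtilde2 D n : ℝ) : ℂ)) else 0)‖ ≤ C * (ell D ^ 10)⁻¹ := by
  obtain ⟨C, hC, D₀, h⟩ := abs_ftilde_sub_gtilde2_le
  refine ⟨C, hC, D₀, fun D _ χ hD hq hp n => ?_⟩
  have hℓ : 0 ≤ (ell D ^ 10)⁻¹ := inv_nonneg.mpr (pow_nonneg (Real.log_natCast_nonneg D) 10)
  by_cases hn : n ∈ frakI2Nat D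
  · rw [if_pos hn, norm_mul, ← Complex.ofReal_sub, Complex.norm_real, Real.norm_eq_abs]
    calc ‖χ (n : ZMod D)‖ *
          |ftilde (Real.log n / Real.log (bigP D) + 0.004 - alphaTilde D) - gtilde2 D n|
        ≤ 1 * (C * (ell D ^ 10)⁻¹) :=
          mul_le_mul (DirichletCharacter.norm_le_one _ _) (h D χ hD hq hp n hn) (abs_nonneg _)
            zero_le_one
      _ = C * (ell D ^ 10)⁻¹ := one_mul _
  · rw [if_neg hn, norm_zero]; positivity

/-! ### The supports are unions of three windows `(xη₋, xη₊)` -/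

/-- **`𝔍₂ ∩ ℕ` as three windows**: `n ∈ frakI2Nat D` iff `x_aη₋ < n < x_aη₊` for some
`a ∈ {0.5, 0.502, 0.504}`, with centres `x_a = P^a·Dt₀/P^{0.004}` (`D ≥ 2`). (For `𝔍₁ ∩ ℕ` the
analogous statement with centres `P^a` is the tree's `mem_frakI1Nat_iff` + `mem_frakI1_iff`.)
[cite: Zhang2022LandauSiegel, §11 p. 64, tex L3306; §2 (2.30)] -/
theorem mem_frakI2Nat_iff_windows {D : ℕ} (hD : 2 ≤ D) (n : ℕ) :
    n ∈ frakI2Nat D ↔ ∃ a ∈ ({0.5, 0.502, 0.504} : Finset ℝ),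
      bigP D ^ a * ((D : ℝ) * t0 D) / bigP D ^ (0.004 : ℝ) * etaPM D (-1) < n ∧
        (n : ℝ) < bigP D ^ a * ((D : ℝ) * t0 D) / bigP D ^ (0.004 : ℝ) * etaPM D 1 := by
  have hP0 : 0 < bigP D := Real.exp_pos _
  have hP4 : 0 < bigP D ^ (0.004 : ℝ) := Real.rpow_pos_of_pos hP0 _
  have hD0 : (0 : ℝ) < D := by exact_mod_cast (by omega : 0 < D)
  have hℓ0 : 0 < ell D := by
    rw [ell]; exact Real.log_pos (by exact_mod_cast (by omega : 1 < D))
  have hDt : 0 < (D : ℝ) * t0 D := mul_pos hD0 (pow_pos hℓ0 _)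
  rw [mem_frakI2Nat_iff hD, mem_frakI1_iff]
  refine exists_congr fun a => and_congr_right fun _ => ?_
  rw [scaleJ2, lt_div_iff₀ hDt, div_lt_iff₀ hDt]
  constructor
  · rintro ⟨h1, h2⟩
    constructor
    · rw [div_mul_eq_mul_div, div_lt_iff₀ hP4]
      calc bigP D ^ a * ((D : ℝ) * t0 D) * etaPM D (-1)
          = bigP D ^ a * etaPM D (-1) * ((D : ℝ) * t0 D) := by ring
        _ < (n : ℝ) * bigP D ^ (0.004 : ℝ) := h1
    · rw [div_mul_eq_mul_div, lt_div_iff₀ hP4]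
      calc (n : ℝ) * bigP D ^ (0.004 : ℝ) < bigP D ^ a * etaPM D 1 * ((D : ℝ) * t0 D) := h2
        _ = bigP D ^ a * ((D : ℝ) * t0 D) * etaPM D 1 := by ring
  · rintro ⟨h1, h2⟩
    rw [div_mul_eq_mul_div, div_lt_iff₀ hP4] at h1
    rw [div_mul_eq_mul_div, lt_div_iff₀ hP4] at h2
    constructor
    · calc bigP D ^ a * etaPM D (-1) * ((D : ℝ) * t0 D)
          = bigP D ^ a * ((D : ℝ) * t0 D) * etaPM D (-1) := by ring
        _ < (n : ℝ) * bigP D ^ (0.004 : ℝ) := h1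
    · calc (n : ℝ) * bigP D ^ (0.004 : ℝ) < bigP D ^ a * ((D : ℝ) * t0 D) * etaPM D 1 := h2
        _ = bigP D ^ a * etaPM D 1 * ((D : ℝ) * t0 D) := by ring

/-- The three `𝔍₂`-centres `x_a = P^a·Dt₀/P^{0.004}` (`a ∈ {0.5, 0.502, 0.504}`) are positive and at
most `P₁Dt₀` (`P^{0.004} ≥ 1`, `P^a ≤ P^{0.504}`), `D ≥ 2`. [cite: Zhang2022LandauSiegel, §11 p. 64] -/
theorem windowCentre₂_le_P1_mul {D : ℕ} (hD : 2 ≤ D) {a : ℝ}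
    (ha : a ∈ ({0.5, 0.502, 0.504} : Finset ℝ)) :
    0 < bigP D ^ a * ((D : ℝ) * t0 D) / bigP D ^ (0.004 : ℝ) ∧
      bigP D ^ a * ((D : ℝ) * t0 D) / bigP D ^ (0.004 : ℝ) ≤ Skeleton.P1 D * ((D : ℝ) * t0 D) := by
  have hP0 : 0 < bigP D := Real.exp_pos _
  have hP1 : 1 ≤ bigP D := Real.one_le_exp (pow_nonneg (Real.log_natCast_nonneg D) 9)
  have hP4 : 1 ≤ bigP D ^ (0.004 : ℝ) := Real.one_le_rpow hP1 (by norm_num)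
  have hD0 : (0 : ℝ) < D := by exact_mod_cast (by omega : 0 < D)
  have hℓ0 : 0 < ell D := by
    rw [ell]; exact Real.log_pos (by exact_mod_cast (by omega : 1 < D))
  have hDt : 0 < (D : ℝ) * t0 D := mul_pos hD0 (pow_pos hℓ0 _)
  have ha' : a ≤ 0.504 := by
    simp only [Finset.mem_insert, Finset.mem_singleton] at ha
    rcases ha with rfl | rfl | rfl <;> norm_num
  refine ⟨by positivity, ?_⟩
  calc bigP D ^ a * ((D : ℝ) * t0 D) / bigP D ^ (0.004 : ℝ)
      ≤ bigP D ^ a * ((D : ℝ) * t0 D) := div_le_self (by positivity) hP4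
    _ ≤ Skeleton.P1 D * ((D : ℝ) * t0 D) :=
        mul_le_mul_of_nonneg_right (Real.rpow_le_rpow_of_exponent_le hP1 ha') hDt.le

/-- The three `𝔍₁`-centres `P^a` (`a ∈ {0.5, 0.502, 0.504}`) are positive and at most `P₁`.
[cite: Zhang2022LandauSiegel, §11 p. 64] -/
theorem windowCentre_le_P1 (D : ℕ) {a : ℝ} (ha : a ∈ ({0.5, 0.502, 0.504} : Finset ℝ)) :
    0 < bigP D ^ a ∧ bigP D ^ a ≤ Skeleton.P1 D := by
  have hP0 : 0 < bigP D := Real.exp_pos _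
  have hP1 : 1 ≤ bigP D := Real.one_le_exp (pow_nonneg (Real.log_natCast_nonneg D) 9)
  have ha' : a ≤ 0.504 := by
    simp only [Finset.mem_insert, Finset.mem_singleton] at ha
    rcases ha with rfl | rfl | rfl <;> norm_num
  exact ⟨Real.rpow_pos_of_pos hP0 a, Real.rpow_le_rpow_of_exponent_le hP1 ha'⟩

end Literature.NumberTheory.LFunctions.Zhang2022.Section11WindowMeanSquare
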